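import Mathlib.FieldTheory.Galois.Abelian
import Mathlib.FieldTheory.IsAlgClosed.AlgebraicClosure
import HarnessLib

/-!
# The Kronecker–Weber theorem (named fact)

The **Kronecker–Weber theorem**: every finite abelian extension of `ℚ` is contained in a
cyclotomic field `ℚ(ζₘ)`.  Washington, *Introduction to Cyclotomic Fields* (2nd ed. 1997),
Ch. 14, Theorem 14.1; Childress, *Class Field Theory* (2009), Ch. 6, Theorem 3.8 ("Every finite
abelian extension `F` of `ℚ` satisfies `F ⊆ ℚ(ζ)` for some root of unity `ζ`."); Cassels,
*Local Fields* (1986), Ch. 10 §12, Theorem 12.2 ("Let `k/ℚ` be an abelian extension.  Then `k` is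
contained in a cyclotomic field."; there an extension is *abelian* if it is normal with abelian
Galois group and *cyclotomic* if generated by a root of unity).  Neither the theorem nor the
global class field theory / ramification theory it rests on
is in Mathlib, so it is vendored here as a named fact `Literature.KroneckerWeber : Prop` (D-0014), via the
predicate `Literature.IsKroneckerWeber K` ("every finite abelian subextension of `K̄/K` lies in some
`K(μ_m)`") evaluated at `K = ℚ`.  Working inside the fixed algebraic closure
`AlgebraicClosure ℚ` (the one underlying `Field.absoluteGaloisGroup ℚ`) loses nothing: every
finite extension of `ℚ` embeds into it.

## Main definitions

* `Literature.IsKroneckerWeber K`: every intermediate field `L` of `K̄/K` that is finite-dimensional and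
  abelian Galois over `K` (Mathlib's `IsAbelianGalois`) satisfies `L ≤ K(μ_m)` for some `m ≥ 1`,
  where `K(μ_m) = IntermediateField.adjoin K {ζ | ζ ^ m = 1}`.
* `Literature.KroneckerWeber : Prop := IsKroneckerWeber ℚ` — the theorem, as a named fact.

## API

* `Literature.NumberTheory.GaloisRepresentations.IsKroneckerWeber.exists_le_adjoin`: instance-argument form.
* `Literature.NumberTheory.GaloisRepresentations.isKroneckerWeber_of_isAlgClosed`: an algebraically closed field has the property
  trivially (non-vacuity of the predicate's shape; of course the content is at `K = ℚ`).

## References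

* [Washington1997] L. C. Washington, *Introduction to Cyclotomic Fields*, 2nd ed., GTM 83,
  Springer (1997), Ch. 14, Thm. 14.1.
* [Childress2009] N. Childress, *Class Field Theory*, Universitext, Springer (2009), Ch. 6,
  Thm. 3.8.
* [Cassels1986] J. W. S. Cassels, *Local Fields*, LMS Student Texts 3, CUP (1986), Ch. 10 §12,
  Thm. 12.2 (p. 235); local version Ch. 8 §4, Thm. 4.1.
-/

noncomputable section

universe u

namespace Literature.NumberTheory.GaloisRepresentations

/-- A field `K` **has the Kronecker–Weber property**: every intermediate field `L` of `K̄/K`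
(`K̄ = AlgebraicClosure K`) which is finite-dimensional and abelian Galois over `K`
(`IsAbelianGalois K L`: Galois with commutative Galois group) is contained in the cyclotomic
extension `K(μ_m) ⊆ K̄` generated by the `m`-th roots of unity of `K̄`, for some `m ≥ 1`.
The Kronecker–Weber theorem says that `ℚ` has this property (`KroneckerWeber`); so does, e.g.,
every algebraically closed field (`isKroneckerWeber_of_isAlgClosed`), while imaginary quadratic
fields do not.  Ref: Washington, *Introduction to Cyclotomic Fields* (1997), Ch. 14;
Cassels, *Local Fields* (1986), Ch. 10 §12. [folklore] -/
def IsKroneckerWeber (K : Type u) [Field K] : Prop :=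
  ∀ L : IntermediateField K (AlgebraicClosure K), FiniteDimensional K L → IsAbelianGalois K L →
    ∃ m : ℕ, 0 < m ∧ L ≤ IntermediateField.adjoin K {ζ : AlgebraicClosure K | ζ ^ m = 1}

/-- **The Kronecker–Weber theorem** (named fact, not in Mathlib): every finite abelian extension
of `ℚ` — here: every finite-dimensional abelian Galois intermediate field `L` of `ℚ̄/ℚ` — is
contained in a cyclotomic field `ℚ(μ_m) = ℚ(ζ : ζ ^ m = 1) ⊆ ℚ̄` for some `m ≥ 1`.
Washington, Thm. 14.1: "Let `K/ℚ` be a finite abelian extension.  Then `K ⊆ ℚ(ζₙ)` for some `n`";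
Childress, Ch. 6, Thm. 3.8: "Every finite abelian extension `F` of `ℚ` satisfies `F ⊆ ℚ(ζ)` for
some root of unity `ζ`"; Cassels, Ch. 10, Thm. 12.2: "Let `k/ℚ` be an abelian extension.  Then
`k` is contained in a cyclotomic field."  (Here `ℚ(μ_m) ⊆ ℚ̄` is generated by a primitive `m`-th
root of unity, which `ℚ̄` contains.)
[cite: Washington1997, Ch. 14, Thm. 14.1] [cite: Childress2009, Ch. 6, Thm. 3.8] [cite: Cassels1986, Ch. 10 §12, Thm. 12.2 (p. 235)] -/
def KroneckerWeber : Prop :=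
  IsKroneckerWeber ℚ

/-- Unfolding `KroneckerWeber`. [folklore] -/
theorem kroneckerWeber_iff : KroneckerWeber ↔ IsKroneckerWeber ℚ := Iff.rfl

variable {K : Type u} [Field K]

/-- Instance-argument form of the Kronecker–Weber property: a finite abelian Galois `L ⊆ K̄` lies
in `K(μ_m)` for some `m ≥ 1`.  Ref: Washington, *Introduction to Cyclotomic Fields*, Ch. 14. [folklore] -/
theorem IsKroneckerWeber.exists_le_adjoin (h : IsKroneckerWeber K)
    (L : IntermediateField K (AlgebraicClosure K)) [FiniteDimensional K L] [IsAbelianGalois K L] :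
    ∃ m : ℕ, 0 < m ∧ L ≤ IntermediateField.adjoin K {ζ : AlgebraicClosure K | ζ ^ m = 1} :=
  h L inferInstance inferInstance

/-- An algebraically closed field has the Kronecker–Weber property for trivial reasons: every
intermediate field of `K̄/K` is `K` itself (`IntermediateField.eq_bot_of_isAlgClosed_of_isAlgebraic`).
[folklore] -/
theorem isKroneckerWeber_of_isAlgClosed [IsAlgClosed K] : IsKroneckerWeber K := by
  intro L _ _
  refine ⟨1, Nat.one_pos, ?_⟩
  rw [IntermediateField.eq_bot_of_isAlgClosed_of_isAlgebraic L]
  exact bot_le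

end Literature.NumberTheory.GaloisRepresentations
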